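import Summits.CriticalPhenomena.Ising3DConformalLimit.Theorems.MonotoneBlockingMonotoneBlockingTwoKarlinDefs
import Literature.NumberTheory.Sieve.DirichletTupleExpansion
import HarnessLib

/-!
# Stub `blockSum_cellSmear`, line `Sketch` (karlin-scale-tp2), crux `MonotoneBlockingTwo` (stmt-CriticalPhenomena-17054)

The exact continuum embedding of the block sum.

For a measurable continuum kernel `Γ : ℝ³ → ℝ` (curried), every `L ≥ 1` and every block offset `k ∈ ℤ³`,

  `Σ_{x,y ∈ cube L} (Γ⋆T)(L•k + x − y) = L⁶ · blockIntegral Γ L k`,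

i.e. the double cube sum of the cell-smeared kernel `cellSmearE Γ` is `L⁶` times the nested tent-weighted
scaled block integral.  The registered signature `Sig.stub_blockSum_cellSmear` takes the one-dimensional
lattice→continuum convolution identity `Sig.stub_convolution1D` (stub 4 of the line) as its hypothesis; the
three-dimensional identity is that identity applied once per coordinate, outermost coordinate first
(`L² · L² · L² = L⁶`).  All integrals are nested one-dimensional Lebesgue integrals in `ℝ≥0∞`; the only analytic
inputs are Tonelli for finite sums (`lintegral_finsetSum`) and the measurability of parametric Lebesgue
integrals (`Measurable.lintegral_prod_right'`), which supply the measurability of the test functions fed to the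
one-dimensional identity at each level.
-/

noncomputable section

namespace Summit.CriticalPhenomena.Ising3DConformalLimit.Cruxes.MonotoneBlockingTwo.KarlinScaleTP2

open MeasureTheory Set
open scoped BigOperators ENNReal
open Literature.Probability.LatticeModels

/-! ## Finite-sum bookkeeping -/

/-- A sum over the cube `[0,L)³ ∩ ℤ³` is a triple sum over the three coordinates. -/
theorem sum_cube_eq {M : Type*} [AddCommMonoid M] (L : ℕ) (f : Site 3 → M) :
    ∑ x ∈ cube L, f x =
      ∑ a ∈ Finset.Ico (0:ℤ) L, ∑ b ∈ Finset.Ico (0:ℤ) L, ∑ c ∈ Finset.Ico (0:ℤ) L, f ![a, b, c] := by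
  unfold cube
  rw [Literature.NumberTheory.Sieve.TupleSums.sum_piFinset_succ]
  refine Finset.sum_congr rfl fun a _ => ?_
  rw [Literature.NumberTheory.Sieve.TupleSums.sum_piFinset_succ]
  refine Finset.sum_congr rfl fun b _ => ?_
  rw [Literature.NumberTheory.Sieve.TupleSums.sum_piFinset_succ]
  refine Finset.sum_congr rfl fun c _ => ?_
  rw [Fintype.piFinset_of_isEmpty, Fintype.sum_unique]
  rfl

/-- Reordering a six-fold sum `Σ_{a b c a' b' c'}` into `Σ_{a a' b b' c c'}`. -/
theorem sum_six_comm {M : Type*} [AddCommMonoid M] (s : Finset ℤ) (f : ℤ → ℤ → ℤ → ℤ → ℤ → ℤ → M) :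
    ∑ a ∈ s, ∑ b ∈ s, ∑ c ∈ s, ∑ a' ∈ s, ∑ b' ∈ s, ∑ c' ∈ s, f a b c a' b' c' =
      ∑ a ∈ s, ∑ a' ∈ s, ∑ b ∈ s, ∑ b' ∈ s, ∑ c ∈ s, ∑ c' ∈ s, f a b c a' b' c' :=
  calc ∑ a ∈ s, ∑ b ∈ s, ∑ c ∈ s, ∑ a' ∈ s, ∑ b' ∈ s, ∑ c' ∈ s, f a b c a' b' c'
      = ∑ a ∈ s, ∑ b ∈ s, ∑ a' ∈ s, ∑ c ∈ s, ∑ b' ∈ s, ∑ c' ∈ s, f a b c a' b' c' :=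
        Finset.sum_congr rfl fun _ _ => Finset.sum_congr rfl fun _ _ => Finset.sum_comm
    _ = ∑ a ∈ s, ∑ a' ∈ s, ∑ b ∈ s, ∑ c ∈ s, ∑ b' ∈ s, ∑ c' ∈ s, f a b c a' b' c' :=
        Finset.sum_congr rfl fun _ _ => Finset.sum_comm
    _ = ∑ a ∈ s, ∑ a' ∈ s, ∑ b ∈ s, ∑ b' ∈ s, ∑ c ∈ s, ∑ c' ∈ s, f a b c a' b' c' :=
        Finset.sum_congr rfl fun _ _ => Finset.sum_congr rfl fun _ _ =>
          Finset.sum_congr rfl fun _ _ => Finset.sum_comm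

/-- The cell-smeared kernel at the block-sum argument `L•k + (a,b,c) − (a',b',c')`, with the coordinates
evaluated and the casts pushed into the shape consumed by stub `convolution1D`. -/
theorem cellSmearE_blockArg (Γ : ℝ → ℝ → ℝ → ℝ) (L : ℕ) (k : Site 3) (a b c a' b' c' : ℤ) :
    cellSmearE Γ ((L:ℤ) • k + ![a, b, c] - ![a', b', c']) =
      ∫⁻ u₁ in Ico (0:ℝ) 1, ∫⁻ v₁ in Ico (0:ℝ) 1, ∫⁻ u₂ in Ico (0:ℝ) 1, ∫⁻ v₂ in Ico (0:ℝ) 1,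
        ∫⁻ u₃ in Ico (0:ℝ) 1, ∫⁻ v₃ in Ico (0:ℝ) 1,
          ENNReal.ofReal (Γ ((L:ℝ) * (k 0 : ℝ) + (a:ℝ) + u₁ - (a':ℝ) - v₁)
            ((L:ℝ) * (k 1 : ℝ) + (b:ℝ) + u₂ - (b':ℝ) - v₂) ((L:ℝ) * (k 2 : ℝ) + (c:ℝ) + u₃ - (c':ℝ) - v₃)) := by
  simp only [cellSmearE, Pi.add_apply, Pi.sub_apply, Pi.smul_apply, smul_eq_mul, Matrix.cons_val,
    Int.cast_add, Int.cast_sub, Int.cast_mul, Int.cast_natCast, sub_add_eq_add_sub]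

/-! ## Tonelli for finite sums through two nested set integrals -/

/-- A finite sum of jointly measurable two-variable families commutes with two nested set integrals. -/
theorem sum_setLIntegral₂ {ι : Type*} (s : Finset ι) (A B : Set ℝ) (F : ι → ℝ → ℝ → ℝ≥0∞)
    (hF : ∀ i, Measurable fun p : ℝ × ℝ => F i p.1 p.2) :
    ∑ i ∈ s, ∫⁻ u in A, ∫⁻ v in B, F i u v = ∫⁻ u in A, ∫⁻ v in B, ∑ i ∈ s, F i u v := by
  have h1 : ∀ i, Measurable fun u => ∫⁻ v in B, F i u v := fun i => (hF i).lintegral_prod_right'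
  have h2 : ∀ i u, Measurable fun v => F i u v := fun i _ => (hF i).comp measurable_prodMk_left
  calc ∑ i ∈ s, ∫⁻ u in A, ∫⁻ v in B, F i u v
      = ∫⁻ u in A, ∑ i ∈ s, ∫⁻ v in B, F i u v := (lintegral_finsetSum s fun i _ => h1 i).symm
    _ = ∫⁻ u in A, ∫⁻ v in B, ∑ i ∈ s, F i u v :=
        lintegral_congr fun u => (lintegral_finsetSum s fun i _ => h2 i u).symm

/-- Two finite sums through two nested set integrals. -/
theorem sum_sum_setLIntegral₂ (s : Finset ℤ) (A B : Set ℝ) (F : ℤ → ℤ → ℝ → ℝ → ℝ≥0∞)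
    (hF : ∀ i j, Measurable fun p : ℝ × ℝ => F i j p.1 p.2) :
    ∑ i ∈ s, ∑ j ∈ s, ∫⁻ u in A, ∫⁻ v in B, F i j u v =
      ∫⁻ u in A, ∫⁻ v in B, ∑ i ∈ s, ∑ j ∈ s, F i j u v :=
  calc ∑ i ∈ s, ∑ j ∈ s, ∫⁻ u in A, ∫⁻ v in B, F i j u v
      = ∑ i ∈ s, ∫⁻ u in A, ∫⁻ v in B, ∑ j ∈ s, F i j u v :=
        Finset.sum_congr rfl fun i _ => sum_setLIntegral₂ s A B (F i) (hF i)
    _ = ∫⁻ u in A, ∫⁻ v in B, ∑ i ∈ s, ∑ j ∈ s, F i j u v :=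
        sum_setLIntegral₂ s A B (fun i u v => ∑ j ∈ s, F i j u v)
          fun i => Finset.measurable_sum s fun j _ => hF i j

/-- Four finite sums through two nested set integrals. -/
theorem sum_four_setLIntegral₂ (s : Finset ℤ) (A B : Set ℝ) (F : ℤ → ℤ → ℤ → ℤ → ℝ → ℝ → ℝ≥0∞)
    (hF : ∀ i j i' j', Measurable fun p : ℝ × ℝ => F i j i' j' p.1 p.2) :
    ∑ i ∈ s, ∑ j ∈ s, ∑ i' ∈ s, ∑ j' ∈ s, ∫⁻ u in A, ∫⁻ v in B, F i j i' j' u v =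
      ∫⁻ u in A, ∫⁻ v in B, ∑ i ∈ s, ∑ j ∈ s, ∑ i' ∈ s, ∑ j' ∈ s, F i j i' j' u v :=
  calc ∑ i ∈ s, ∑ j ∈ s, ∑ i' ∈ s, ∑ j' ∈ s, ∫⁻ u in A, ∫⁻ v in B, F i j i' j' u v
      = ∑ i ∈ s, ∑ j ∈ s, ∫⁻ u in A, ∫⁻ v in B, ∑ i' ∈ s, ∑ j' ∈ s, F i j i' j' u v :=
        Finset.sum_congr rfl fun i _ => Finset.sum_congr rfl fun j _ =>
          sum_sum_setLIntegral₂ s A B (F i j) (hF i j)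
    _ = ∫⁻ u in A, ∫⁻ v in B, ∑ i ∈ s, ∑ j ∈ s, ∑ i' ∈ s, ∑ j' ∈ s, F i j i' j' u v :=
        sum_sum_setLIntegral₂ s A B (fun i j u v => ∑ i' ∈ s, ∑ j' ∈ s, F i j i' j' u v)
          fun i j => Finset.measurable_sum s fun i' _ => Finset.measurable_sum s fun j' _ => hF i j i' j'

/-! ## Measurability of the parametric cell integrals -/

section Measurability

variable {Γ : ℝ → ℝ → ℝ → ℝ} (hΓ : Measurable fun p : ℝ × ℝ × ℝ => Γ p.1 p.2.1 p.2.2)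
include hΓ

/-- `ofReal ∘ Γ` along three measurable coordinate maps is measurable. -/
theorem measurable_ofReal_comp₃ {α : Type*} [MeasurableSpace α] {f g h : α → ℝ} (hf : Measurable f)
    (hg : Measurable g) (hh : Measurable h) :
    Measurable fun x => ENNReal.ofReal (Γ (f x) (g x) (h x)) :=
  ENNReal.measurable_ofReal.comp (hΓ.comp (hf.prodMk (hg.prodMk hh)))

/-- Joint measurability of `((p,t),u) ↦ ∫_{[0,1)} ofReal (Γ p t (Q + u − R − v)) dv`. -/
theorem measurable_cell₁ (Q R : ℝ) :
    Measurable fun q : (ℝ × ℝ) × ℝ =>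
      ∫⁻ v in Ico (0:ℝ) 1, ENNReal.ofReal (Γ q.1.1 q.1.2 (Q + q.2 - R - v)) := by
  have h : Measurable fun r : ((ℝ × ℝ) × ℝ) × ℝ =>
      ENNReal.ofReal (Γ r.1.1.1 r.1.1.2 (Q + r.1.2 - R - r.2)) :=
    measurable_ofReal_comp₃ hΓ (by fun_prop) (by fun_prop) (by fun_prop)
  exact h.lintegral_prod_right'

/-- Joint measurability of `(p,t) ↦ ∫_{[0,1)}∫_{[0,1)} ofReal (Γ p t (Q + u − R − v)) dv du`. -/
theorem measurable_cell₂ (Q R : ℝ) :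
    Measurable fun q : ℝ × ℝ =>
      ∫⁻ u in Ico (0:ℝ) 1, ∫⁻ v in Ico (0:ℝ) 1, ENNReal.ofReal (Γ q.1 q.2 (Q + u - R - v)) :=
  (measurable_cell₁ hΓ Q R).lintegral_prod_right'

/-- Joint measurability of `(t,u) ↦ ∫∫∫ ofReal (Γ t (Q + u − R − v) (Q' + u' − R' − v')) dv' du' dv`. -/
theorem measurable_cell₃ (Q R Q' R' : ℝ) :
    Measurable fun q : ℝ × ℝ => ∫⁻ v in Ico (0:ℝ) 1, ∫⁻ u' in Ico (0:ℝ) 1, ∫⁻ v' in Ico (0:ℝ) 1,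
      ENNReal.ofReal (Γ q.1 (Q + q.2 - R - v) (Q' + u' - R' - v')) := by
  have hm : Measurable fun r : (ℝ × ℝ) × ℝ => (r.1.1, Q + r.1.2 - R - r.2) := by fun_prop
  exact ((measurable_cell₂ hΓ Q' R').comp hm).lintegral_prod_right'

/-- Measurability of the level-one test function summand
`t ↦ ∫∫∫∫ ofReal (Γ t (Q + u − R − v) (Q' + u' − R' − v')) dv' du' dv du`. -/
theorem measurable_cell₄ (Q R Q' R' : ℝ) :
    Measurable fun t : ℝ => ∫⁻ u in Ico (0:ℝ) 1, ∫⁻ v in Ico (0:ℝ) 1, ∫⁻ u' in Ico (0:ℝ) 1,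
      ∫⁻ v' in Ico (0:ℝ) 1, ENNReal.ofReal (Γ t (Q + u - R - v) (Q' + u' - R' - v')) :=
  (measurable_cell₃ hΓ Q R Q' R').lintegral_prod_right'

end Measurability

/-! ## The identity, one coordinate at a time (innermost coordinate = level three) -/

/-- Level three: the one-dimensional identity in the last coordinate, the first two arguments frozen. -/
theorem blockSum_level₃ (h1d : Sig.stub_convolution1D) {Γ : ℝ → ℝ → ℝ → ℝ}
    (hΓ : Measurable fun p : ℝ × ℝ × ℝ => Γ p.1 p.2.1 p.2.2) (L : ℕ) (hL : 1 ≤ L) (κ : ℤ) (p q : ℝ) :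
    ∑ c ∈ Finset.Ico (0:ℤ) L, ∑ c' ∈ Finset.Ico (0:ℤ) L, ∫⁻ u in Ico (0:ℝ) 1, ∫⁻ v in Ico (0:ℝ) 1,
        ENNReal.ofReal (Γ p q ((L:ℝ) * (κ:ℝ) + (c:ℝ) + u - (c':ℝ) - v)) =
      ((L:ℝ≥0∞) ^ 2) * ∫⁻ s, ENNReal.ofReal (tent (s - (κ:ℝ))) * ENNReal.ofReal (Γ p q ((L:ℝ) * s)) :=
  h1d (fun t => ENNReal.ofReal (Γ p q t))
    (measurable_ofReal_comp₃ hΓ measurable_const measurable_const measurable_id) L hL κ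

/-- Level two: the identity in the last two coordinates, the first argument frozen (`L² · L²`). -/
theorem blockSum_level₂ (h1d : Sig.stub_convolution1D) {Γ : ℝ → ℝ → ℝ → ℝ}
    (hΓ : Measurable fun p : ℝ × ℝ × ℝ => Γ p.1 p.2.1 p.2.2) (L : ℕ) (hL : 1 ≤ L) (κ κ' : ℤ) (p : ℝ) :
    ∑ b ∈ Finset.Ico (0:ℤ) L, ∑ b' ∈ Finset.Ico (0:ℤ) L, ∑ c ∈ Finset.Ico (0:ℤ) L,
      ∑ c' ∈ Finset.Ico (0:ℤ) L,
        ∫⁻ u in Ico (0:ℝ) 1, ∫⁻ v in Ico (0:ℝ) 1, ∫⁻ u' in Ico (0:ℝ) 1, ∫⁻ v' in Ico (0:ℝ) 1,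
          ENNReal.ofReal (Γ p ((L:ℝ) * (κ:ℝ) + (b:ℝ) + u - (b':ℝ) - v)
            ((L:ℝ) * (κ':ℝ) + (c:ℝ) + u' - (c':ℝ) - v')) =
      ((L:ℝ≥0∞) ^ 2) * (((L:ℝ≥0∞) ^ 2) * ∫⁻ s, ENNReal.ofReal (tent (s - (κ:ℝ))) *
        ∫⁻ s', ENNReal.ofReal (tent (s' - (κ':ℝ))) * ENNReal.ofReal (Γ p ((L:ℝ) * s) ((L:ℝ) * s'))) := by
  have hφ : Measurable fun t : ℝ => ∑ c ∈ Finset.Ico (0:ℤ) L, ∑ c' ∈ Finset.Ico (0:ℤ) L,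
      ∫⁻ u' in Ico (0:ℝ) 1, ∫⁻ v' in Ico (0:ℝ) 1,
        ENNReal.ofReal (Γ p t ((L:ℝ) * (κ':ℝ) + (c:ℝ) + u' - (c':ℝ) - v')) :=
    Finset.measurable_sum _ fun c _ => Finset.measurable_sum _ fun c' _ =>
      (measurable_cell₂ hΓ ((L:ℝ) * (κ':ℝ) + (c:ℝ)) (c':ℝ)).comp measurable_prodMk_left
  calc ∑ b ∈ Finset.Ico (0:ℤ) L, ∑ b' ∈ Finset.Ico (0:ℤ) L, ∑ c ∈ Finset.Ico (0:ℤ) L,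
        ∑ c' ∈ Finset.Ico (0:ℤ) L,
          ∫⁻ u in Ico (0:ℝ) 1, ∫⁻ v in Ico (0:ℝ) 1, ∫⁻ u' in Ico (0:ℝ) 1, ∫⁻ v' in Ico (0:ℝ) 1,
            ENNReal.ofReal (Γ p ((L:ℝ) * (κ:ℝ) + (b:ℝ) + u - (b':ℝ) - v)
              ((L:ℝ) * (κ':ℝ) + (c:ℝ) + u' - (c':ℝ) - v'))
      = ∑ b ∈ Finset.Ico (0:ℤ) L, ∑ b' ∈ Finset.Ico (0:ℤ) L,
          ∫⁻ u in Ico (0:ℝ) 1, ∫⁻ v in Ico (0:ℝ) 1, ∑ c ∈ Finset.Ico (0:ℤ) L, ∑ c' ∈ Finset.Ico (0:ℤ) L,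
            ∫⁻ u' in Ico (0:ℝ) 1, ∫⁻ v' in Ico (0:ℝ) 1,
              ENNReal.ofReal (Γ p ((L:ℝ) * (κ:ℝ) + (b:ℝ) + u - (b':ℝ) - v)
                ((L:ℝ) * (κ':ℝ) + (c:ℝ) + u' - (c':ℝ) - v')) :=
        Finset.sum_congr rfl fun b _ => Finset.sum_congr rfl fun b' _ =>
          sum_sum_setLIntegral₂ _ _ _
            (fun c c' u v => ∫⁻ u' in Ico (0:ℝ) 1, ∫⁻ v' in Ico (0:ℝ) 1,
              ENNReal.ofReal (Γ p ((L:ℝ) * (κ:ℝ) + (b:ℝ) + u - (b':ℝ) - v)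
                ((L:ℝ) * (κ':ℝ) + (c:ℝ) + u' - (c':ℝ) - v')))
            fun c c' => (measurable_cell₂ hΓ ((L:ℝ) * (κ':ℝ) + (c:ℝ)) (c':ℝ)).comp
              (show Measurable fun w : ℝ × ℝ => (p, (L:ℝ) * (κ:ℝ) + (b:ℝ) + w.1 - (b':ℝ) - w.2) by
                fun_prop)
    _ = ((L:ℝ≥0∞) ^ 2) * ∫⁻ s, ENNReal.ofReal (tent (s - (κ:ℝ))) *
          ∑ c ∈ Finset.Ico (0:ℤ) L, ∑ c' ∈ Finset.Ico (0:ℤ) L,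
            ∫⁻ u' in Ico (0:ℝ) 1, ∫⁻ v' in Ico (0:ℝ) 1,
              ENNReal.ofReal (Γ p ((L:ℝ) * s) ((L:ℝ) * (κ':ℝ) + (c:ℝ) + u' - (c':ℝ) - v')) :=
        h1d _ hφ L hL κ
    _ = ((L:ℝ≥0∞) ^ 2) * ∫⁻ s, ENNReal.ofReal (tent (s - (κ:ℝ))) * (((L:ℝ≥0∞) ^ 2) *
          ∫⁻ s', ENNReal.ofReal (tent (s' - (κ':ℝ))) * ENNReal.ofReal (Γ p ((L:ℝ) * s) ((L:ℝ) * s'))) := by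
        congr 1
        exact lintegral_congr fun s => by rw [blockSum_level₃ h1d hΓ L hL κ' p ((L:ℝ) * s)]
    _ = ((L:ℝ≥0∞) ^ 2) * (((L:ℝ≥0∞) ^ 2) * ∫⁻ s, ENNReal.ofReal (tent (s - (κ:ℝ))) *
          ∫⁻ s', ENNReal.ofReal (tent (s' - (κ':ℝ))) * ENNReal.ofReal (Γ p ((L:ℝ) * s) ((L:ℝ) * s'))) := by
        congr 1
        rw [← lintegral_const_mul' _ _ (ENNReal.pow_ne_top (ENNReal.natCast_ne_top L))]
        exact lintegral_congr fun s => mul_left_comm _ _ _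

/-- **Stub `blockSum_cellSmear`** (STUB 5 of line `Sketch`, idea `karlin-scale-tp2`): granted the
one-dimensional lattice→continuum convolution identity (stub `convolution1D`), for every measurable kernel
`Γ`, every `L ≥ 1` and every `k ∈ ℤ³`,
`Σ_{x,y ∈ cube L} cellSmearE Γ (L•k + x − y) = L⁶ · blockIntegral Γ L k`. -/
theorem stub_blockSum_cellSmear : Sig.stub_blockSum_cellSmear := by
  intro h1d Γ hΓ L hL k
  have hφ : Measurable fun t : ℝ => ∑ b ∈ Finset.Ico (0:ℤ) L, ∑ b' ∈ Finset.Ico (0:ℤ) L,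
      ∑ c ∈ Finset.Ico (0:ℤ) L, ∑ c' ∈ Finset.Ico (0:ℤ) L,
        ∫⁻ u in Ico (0:ℝ) 1, ∫⁻ v in Ico (0:ℝ) 1, ∫⁻ u' in Ico (0:ℝ) 1, ∫⁻ v' in Ico (0:ℝ) 1,
          ENNReal.ofReal (Γ t ((L:ℝ) * (k 1 : ℝ) + (b:ℝ) + u - (b':ℝ) - v)
            ((L:ℝ) * (k 2 : ℝ) + (c:ℝ) + u' - (c':ℝ) - v')) :=
    Finset.measurable_sum _ fun b _ => Finset.measurable_sum _ fun b' _ =>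
      Finset.measurable_sum _ fun c _ => Finset.measurable_sum _ fun c' _ =>
        measurable_cell₄ hΓ ((L:ℝ) * (k 1 : ℝ) + (b:ℝ)) (b':ℝ) ((L:ℝ) * (k 2 : ℝ) + (c:ℝ)) (c':ℝ)
  calc ∑ x ∈ cube L, ∑ y ∈ cube L, cellSmearE Γ ((L:ℤ) • k + x - y)
      = ∑ a ∈ Finset.Ico (0:ℤ) L, ∑ b ∈ Finset.Ico (0:ℤ) L, ∑ c ∈ Finset.Ico (0:ℤ) L,
          ∑ a' ∈ Finset.Ico (0:ℤ) L, ∑ b' ∈ Finset.Ico (0:ℤ) L, ∑ c' ∈ Finset.Ico (0:ℤ) L,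
            ∫⁻ u₁ in Ico (0:ℝ) 1, ∫⁻ v₁ in Ico (0:ℝ) 1, ∫⁻ u₂ in Ico (0:ℝ) 1, ∫⁻ v₂ in Ico (0:ℝ) 1,
              ∫⁻ u₃ in Ico (0:ℝ) 1, ∫⁻ v₃ in Ico (0:ℝ) 1,
                ENNReal.ofReal (Γ ((L:ℝ) * (k 0 : ℝ) + (a:ℝ) + u₁ - (a':ℝ) - v₁)
                  ((L:ℝ) * (k 1 : ℝ) + (b:ℝ) + u₂ - (b':ℝ) - v₂)
                  ((L:ℝ) * (k 2 : ℝ) + (c:ℝ) + u₃ - (c':ℝ) - v₃)) := by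
        simp only [sum_cube_eq, cellSmearE_blockArg]
    _ = ∑ a ∈ Finset.Ico (0:ℤ) L, ∑ a' ∈ Finset.Ico (0:ℤ) L, ∑ b ∈ Finset.Ico (0:ℤ) L,
          ∑ b' ∈ Finset.Ico (0:ℤ) L, ∑ c ∈ Finset.Ico (0:ℤ) L, ∑ c' ∈ Finset.Ico (0:ℤ) L,
            ∫⁻ u₁ in Ico (0:ℝ) 1, ∫⁻ v₁ in Ico (0:ℝ) 1, ∫⁻ u₂ in Ico (0:ℝ) 1, ∫⁻ v₂ in Ico (0:ℝ) 1,
              ∫⁻ u₃ in Ico (0:ℝ) 1, ∫⁻ v₃ in Ico (0:ℝ) 1,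
                ENNReal.ofReal (Γ ((L:ℝ) * (k 0 : ℝ) + (a:ℝ) + u₁ - (a':ℝ) - v₁)
                  ((L:ℝ) * (k 1 : ℝ) + (b:ℝ) + u₂ - (b':ℝ) - v₂)
                  ((L:ℝ) * (k 2 : ℝ) + (c:ℝ) + u₃ - (c':ℝ) - v₃)) :=
        sum_six_comm _ _
    _ = ∑ a ∈ Finset.Ico (0:ℤ) L, ∑ a' ∈ Finset.Ico (0:ℤ) L,
          ∫⁻ u₁ in Ico (0:ℝ) 1, ∫⁻ v₁ in Ico (0:ℝ) 1,
            ∑ b ∈ Finset.Ico (0:ℤ) L, ∑ b' ∈ Finset.Ico (0:ℤ) L, ∑ c ∈ Finset.Ico (0:ℤ) L,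
              ∑ c' ∈ Finset.Ico (0:ℤ) L,
                ∫⁻ u₂ in Ico (0:ℝ) 1, ∫⁻ v₂ in Ico (0:ℝ) 1, ∫⁻ u₃ in Ico (0:ℝ) 1, ∫⁻ v₃ in Ico (0:ℝ) 1,
                  ENNReal.ofReal (Γ ((L:ℝ) * (k 0 : ℝ) + (a:ℝ) + u₁ - (a':ℝ) - v₁)
                    ((L:ℝ) * (k 1 : ℝ) + (b:ℝ) + u₂ - (b':ℝ) - v₂)
                    ((L:ℝ) * (k 2 : ℝ) + (c:ℝ) + u₃ - (c':ℝ) - v₃)) :=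
        Finset.sum_congr rfl fun a _ => Finset.sum_congr rfl fun a' _ =>
          sum_four_setLIntegral₂ _ _ _
            (fun b b' c c' u₁ v₁ => ∫⁻ u₂ in Ico (0:ℝ) 1, ∫⁻ v₂ in Ico (0:ℝ) 1, ∫⁻ u₃ in Ico (0:ℝ) 1,
              ∫⁻ v₃ in Ico (0:ℝ) 1,
                ENNReal.ofReal (Γ ((L:ℝ) * (k 0 : ℝ) + (a:ℝ) + u₁ - (a':ℝ) - v₁)
                  ((L:ℝ) * (k 1 : ℝ) + (b:ℝ) + u₂ - (b':ℝ) - v₂)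
                  ((L:ℝ) * (k 2 : ℝ) + (c:ℝ) + u₃ - (c':ℝ) - v₃)))
            fun b b' c c' =>
              (measurable_cell₄ hΓ ((L:ℝ) * (k 1 : ℝ) + (b:ℝ)) (b':ℝ) ((L:ℝ) * (k 2 : ℝ) + (c:ℝ))
                  (c':ℝ)).comp
                (show Measurable fun w : ℝ × ℝ => (L:ℝ) * (k 0 : ℝ) + (a:ℝ) + w.1 - (a':ℝ) - w.2 by
                  fun_prop)
    _ = ((L:ℝ≥0∞) ^ 2) * ∫⁻ s₁, ENNReal.ofReal (tent (s₁ - (k 0 : ℝ))) *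
          ∑ b ∈ Finset.Ico (0:ℤ) L, ∑ b' ∈ Finset.Ico (0:ℤ) L, ∑ c ∈ Finset.Ico (0:ℤ) L,
            ∑ c' ∈ Finset.Ico (0:ℤ) L,
              ∫⁻ u₂ in Ico (0:ℝ) 1, ∫⁻ v₂ in Ico (0:ℝ) 1, ∫⁻ u₃ in Ico (0:ℝ) 1, ∫⁻ v₃ in Ico (0:ℝ) 1,
                ENNReal.ofReal (Γ ((L:ℝ) * s₁) ((L:ℝ) * (k 1 : ℝ) + (b:ℝ) + u₂ - (b':ℝ) - v₂)
                  ((L:ℝ) * (k 2 : ℝ) + (c:ℝ) + u₃ - (c':ℝ) - v₃)) :=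
        h1d _ hφ L hL (k 0)
    _ = ((L:ℝ≥0∞) ^ 2) * ∫⁻ s₁, ENNReal.ofReal (tent (s₁ - (k 0 : ℝ))) *
          (((L:ℝ≥0∞) ^ 2) * (((L:ℝ≥0∞) ^ 2) * ∫⁻ s₂, ENNReal.ofReal (tent (s₂ - (k 1 : ℝ))) *
            ∫⁻ s₃, ENNReal.ofReal (tent (s₃ - (k 2 : ℝ))) *
              ENNReal.ofReal (Γ ((L:ℝ) * s₁) ((L:ℝ) * s₂) ((L:ℝ) * s₃)))) := by
        congr 1
        exact lintegral_congr fun s₁ => by rw [blockSum_level₂ h1d hΓ L hL (k 1) (k 2) ((L:ℝ) * s₁)]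
    _ = ((L:ℝ≥0∞) ^ 6) * blockIntegral Γ (L:ℝ) k := by
        rw [blockIntegral, ← lintegral_const_mul' _ _ (ENNReal.pow_ne_top (ENNReal.natCast_ne_top L)),
          ← lintegral_const_mul' _ _ (ENNReal.pow_ne_top (ENNReal.natCast_ne_top L))]
        exact lintegral_congr fun s₁ => by ring

end Summit.CriticalPhenomena.Ising3DConformalLimit.Cruxes.MonotoneBlockingTwo.KarlinScaleTP2

end
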